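import Mathlib
import HarnessLib
import HarnessLib.Audit
import Summits.AtomisticToContinuum.Statement
import Literature.MathematicalPhysics.StatisticalMechanics.LennardJonesClusters
import Literature.MathematicalPhysics.StatisticalMechanics.HaggStacking
import Literature.MathematicalPhysics.StatisticalMechanics.BarlowStacking
import Literature.MathematicalPhysics.StatisticalMechanics.BarlowStackingEnergy
import Summits.AtomisticToContinuum.Crystallization.Theorems.ExcessDecayLiouvilleCrysEnergyLimit
import Summits.AtomisticToContinuum.Crystallization.Theorems.ThreeConeCertificateDefectVanishCrystallizes
import Summits.AtomisticToContinuum.Crystallization.Theorems.PricedLinkCensusStackingHingeBarlowEnergyIdentification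
import HarnessLib.Audit.Status.Attr

/-!
Route: LuttingerTiszaRegistry

# Route LuttingerTiszaRegistry — Luttinger–Tisza for polytypes — a two-multiplier Toeplitz
certificate Ĵ(θ) ≥ a + b cos θ + q sin²θ forces period 2 with a counted fault price

Realises idea card luttinger-tisza-registry-lp (ideator-16; novelty audits R9/refuter-12:
new-combination). It suffices to show X := LjFaultCountedSelection — the FAULT-COUNTED STACKING
SELECTION INEQUALITY for the actual Lennard-Jones registry couplings J_k(a,h) = barlowCoupling
lennardJones a h k on the relaxation box B = {47/50 ≤ a ≤ 1, 39/50·a ≤ h ≤ 17/20·a} shared with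
routes PoissonBesselStacking / KarpPeierlsStackingLock: for all (a,h) ∈ B, J₂(a,h) < 0 and for EVERY
Hägg sequence s (periodic or not) and every n,
   n·Σ_(k≥2 even) J_k + (|J₂|/2)·#{m < n : s(m+1) = s(m)} ≤ H_n(J, s) + 2·Σ_k k|J_k|
(H_n = haggEnergy: the finite-volume stacking energy; Σ_even J_k = the energy density of ABAB = hcp;
#{s(m+1) = s(m)} = number of cubic letters = deviations from hcp). MECHANISM (Luttinger–Tisza /
Delsarte on the circle group of layer indices): in the registry phase z_m = ω^(label m) the
alignment indicator is LINEAR, 1[aligned(m,m+k)] = (1 + 2 Re z_m z̄_(m+k))/3, the constraint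
'adjacent layers differ' is Re z_m z̄_(m+1) = −1/2, and a certificate Ĵ(θ) := Σ_(k≥2) J_k cos kθ ≥ a
+ b cos θ + q sin²θ (a = Σ_even J_k, b = Σ_odd J_k, q > 0) makes the Toeplitz form with symbol Ĵ − a
− b cos θ − q sin²θ positive semidefinite; expanding it on (z_m)_(m<n) gives X with fault price q/2
(support SpectralFaultBound), and the certificate itself follows from the purely numerical
k²-SPECTRAL DOMINATION Σ_(k≥3) k²|J_k| ≤ 2|J₂|, J₂ < 0 (crux LjSpectralDomination) by the Chebyshev
bound |cos kθ − L_k(cos θ)| ≤ (k²/2) sin²θ (support CertificateFromSpectralDomination). Given X, the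
shared layering crux PeriodicReductionToBarlow and glue give HcpPeriodicMinimiser (relaxed hcp is a
least element over ALL periodic configurations), the bookkeeping limit CrysEnergyLimit gives
conjunct (i), and the shared hinge BulkDefectVanish (whose stacking half consumes exactly the
counted fault price |J₂|/2 ≥ 1.8·10⁻⁵ per fault against the O(N^(2/3)) surface budget) with
DefectVanishCrystallizes gives conjunct (ii). The measure-level corollary (every shift-invariant
registry law on B with specific energy Σ_even J_k has zero fault probability, i.e. is a.s.
2-periodic, with fault density ≤ 2·excess/|J₂|) is X averaged, for the infinite-volume consumers
(BenjaminiSchrammGroundStates (iii), palm-unimodular, hull-minimality cards).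
Lean: `∀ a h : ℝ, 47 / 50 ≤ a → a ≤ 1 → 39 / 50 * a ≤ h → h ≤ 17 / 20 * a →
Literature.MathematicalPhysics.StatisticalMechanics.barlowCoupling
Literature.MathematicalPhysics.StatisticalMechanics.lennardJones a h 2 < 0 ∧ ∀ (s : ℤ → ℤ) (n : ℕ),
Literature.MathematicalPhysics.StatisticalMechanics.IsHaggSeq s → (n : ℝ) * (∑' k : ℕ, (if 2 ≤ k ∧
Even k then Literature.MathematicalPhysics.StatisticalMechanics.barlowCoupling
Literature.MathematicalPhysics.StatisticalMechanics.lennardJones a h k else 0)) +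
|Literature.MathematicalPhysics.StatisticalMechanics.barlowCoupling
Literature.MathematicalPhysics.StatisticalMechanics.lennardJones a h 2| / 2 * (((Finset.range
n).filter (fun m : ℕ => s ((m : ℤ) + 1) = s (m : ℤ))).card : ℝ) ≤
Literature.MathematicalPhysics.StatisticalMechanics.haggEnergy n
(Literature.MathematicalPhysics.StatisticalMechanics.barlowCoupling
Literature.MathematicalPhysics.StatisticalMechanics.lennardJones a h) s + 2 * ∑' k : ℕ, (k : ℝ) *
|Literature.MathematicalPhysics.StatisticalMechanics.barlowCoupling
Literature.MathematicalPhysics.StatisticalMechanics.lennardJones a h k|`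

## Assembly
Pure logic plus IsLeast.csInf_eq, PROVED sorry-free in the planner's Sketch.lean (assembly_provable,
axioms propext/Classical.choice/Quot.sound): EnergeticGlueLT applied to X,
PeriodicReductionToBarlow, BarlowEnergyIdentification, HcpEnergyMinOnBox yields
HcpPeriodicMinimiser, i.e. P = hcpPeriodicConfiguration a h with IsLeast; CrysEnergyLimit is the
Tendsto to ⨅_Q e(Q), rewritten to e(P) by IsLeast.csInf_eq — conjunct HasPeriodicGroundStateEnergy;
DefectVanishCrystallizes applied to BulkDefectVanish and the discharged fact
LennardJonesMinimalDistance gives IsCrystallizing lennardJones 3; the conjunction is Crystallization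
(root abbrev of the Literature statement,
Summits/AtomisticToContinuum/Crystallization/Statement.lean).

Rationale: WHY THIS LINE. Every route of this sub-problem bottoms out in stacking selection and so far proves
it by a Peierls count in Hägg variables (HaggDominationAllRanges 0737, hypothesis J₂ +
Σ_(k≥3)(k−1)|J_k| ≤ 0) or by an LP on de Bruijn words (KarpPeierlsStackingLock, semi-decision in the
window length); this line changes variables to the registry phase, where the Lennard-Jones stacking
functional is a QUADRATIC form in z with one linear constraint, and applies the Luttinger–Tisza
relaxation (LuttingerTisza1946, LyonsKaplan1960: exact when the relaxed minimiser — here the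
spectral measure ¼δ₀ + ¾δ_π of ABAB — is realisable) certified by a Delsarte/Cohn–Kumar-type dual
witness (Delsarte1973, CohnKumar2006: a positive trigonometric polynomial touching at the support)
and Toeplitz positivity (Katznelson2004 §I.6–I.7: positive symbol ⇒ positive semidefinite Toeplitz
form; |sin mφ| ≤ m|sin φ|, PolyaSzego1925 Part VI). Imported areas: ground-state theory of quadratic
spin Hamiltonians (LT method), LP/positive-definite certificates on a compact group (here 𝕋 dual to
ℤ = layer indices), Toeplitz forms; the model is the interlayer-interaction description of
polytypism (PartayOrtnerCsanyi2017 App. A, LoachAckland2017) with the LJ numbers J₂ ≈ −7.25·10⁻⁵, J₃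
≈ −8.5·10⁻⁸ (r⁻⁶ tail beyond √(8/3), Stillinger2001 hcp at p = 0). What it does that prior routes do
not: ONE positive semidefinite form replaces the window combinatorics, the certificate is valid for
all ranges K = ∞ at once and for non-periodic s, it delivers the COUNTED fault price (q/2 per cubic
letter, finite n, O(1) boundary term) that StackingFaultBound 0759 / BulkDefectVanish need and the
measure-level uniqueness that the infinite-volume routes need, and its LJ input is a different,
logically independent numerical inequality (k²-weights instead of (k−1)-weights, margin ≈ 10² on B)
— two independent certificates for the same load-bearing step; SelectionGlue and Assembly are
already proved in the planner's Sketch.lean.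

RANKED CRUXES. #0 LjFaultCountedSelection (target) — X as in § Thesis: for all (a,h) ∈ B, J₂(a,h) <
0 and for every Hägg sequence s and every n, n·Σ_(k≥2 even) J_k(a,h) + (|J₂(a,h)|/2)·#{m < n :
s(m+1) = s(m)} ≤ haggEnergy n J(a,h) s + 2 Σ_k k|J_k(a,h)| (card items L1+L2+L3 composed; follows
from LjSpectralDomination by SelectionGlue, proved in Sketch.lean). (why it might fail: False iff
J₂(a,h) ≥ 0 somewhere on B (|J₂| is smallest, 3.7e−5, at (1, 0.85a)) or the k ≥ 3 tail is not
spectrally dominated there; the constant 2Σk|J_k| has derived slack (8/9)Σk|J_k|.)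
[LuttingerTisza1946, LyonsKaplan1960, LoachAckland2017, PartayOrtnerCsanyi2017, Stillinger2001]
#2 LjSpectralDomination (crux) — (card L3, the ONLY Lennard-Jones input of the line) for all (a,h) ∈
B, with J_k = barlowCoupling lennardJones a h k: Σ_k k²|J_k| < ∞, J₂ < 0 and Σ_(k≥3) k²|J_k| ≤
2|J₂|. Numerics (uncertified; PoissonBesselStacking planner's Bessel series cross-checked by direct
sums, card author's direct sums): J₂ ∈ [−1.5·10⁻⁴, −3.68·10⁻⁵] on B, |J₃|/|J₂| ≤ 1/574, so
Σ_(k≥3)k²|J_k| ≈ 9|J₃| ≈ |J₂|/64 at the worst corner (0.94, 0.78a): margin ≈ 128; already the crude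
tail bound |J_k| ≤ 20e^(−(4π/√3)(h/a)k) of RegistryCouplingBesselTail (3068) plus J₂ ≤ −3.68·10⁻⁵
gives margin ≈ 10. Proof routes: 2-D Poisson summation per layer (J_k a modified-Bessel series, sign
from the −r⁻⁶ part at height kh ≥ 1.47) or direct interval lattice sums with an r⁻⁶ tail bound; the
k² summability alone follows from |J_k| ≤ C(kh)⁻⁴. [difficulty: L] (why it might fail: Uncertified
numerics: needs J₂ < 0 on ALL of B incl. the corner (1, 0.85a) where |J₂| = 3.7e−5 is smallest and
the sign of the layer transform flips at height ≈ 1.11 < 2h; a certified interval evaluation could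
find J₂ ≥ 0 or a fatter k ≥ 3 tail there.) [LoachAckland2017, PartayOrtnerCsanyi2017,
Stillinger2001, LennardjonesDent1928, Steele1973, BeterminPetrache2017, BurrowsEtAl2020]
#3 PeriodicReductionToBarlow (crux) — shared verbatim with stmt-AtomisticToContinuum-3062 (routes
PoissonBesselStacking, KarpPeierlsStackingLock): for every periodic configuration Q of ℝ³ there are
(a,h) ∈ B and a periodic Hägg sequence s such that the uniform Barlow stacking
barlowPeriodicConfiguration a h s has Lennard-Jones energy per particle ≤ that of Q (the genuinely
3-D layering content; this route adds nothing to its mechanism and consumes it as filed).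
[difficulty: XL] (why it might fail: Contains local optimality of close packing among ALL
lattice+motif configurations (open, BlancLewin2015 §2.3); false if a non-close-packed or layer-wise
relaxed polytype beats every uniform Barlow stacking with parameters in B.) [BlancLewin2015,
FlatleyTheil2015, Hales2012, Stillinger2001, PartayOrtnerCsanyi2017, BeterminSamajTravenec2022,
stmt-AtomisticToContinuum-3062]
#4 BulkDefectVanish (crux) — shared verbatim with stmt-AtomisticToContinuum-0751 (routes
CrystalKissingRigidity, PoissonBesselStacking): there is ONE periodic configuration P (the relaxed
hcp) such that for every window radius R and tolerance ε, in every sequence of LJ ground states all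
but o(N) particles have their R-neighbourhood ε-matched both ways by an isometric copy of P's
R-window. Its stacking part is fed by THIS route's counted fault price: by LjFaultCountedSelection
each cubic letter costs ≥ |J₂|/2 ≥ 1.8·10⁻⁵ per column against an O(N^(2/3)) surface budget, so
ground states carry O(1) fault planes per column family; the layering part is
CrystalKissingRigidity's K1/K2 (0750/0758). [deps: LjFaultCountedSelection] [difficulty: XL] (why it
might fail: Needs layering of finite ground states (K1/K2 of CrystalKissingRigidity, unproved;
ε-quasi-twelve-neighbour constructions of Böröczky–Szabó threaten K2); as typed P must be
vertex-transitive — true for hcp, false for dhcp-type limits.) [Hales2012, BlancLewin2015,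
PartayOrtnerCsanyi2017, FlatleyTheil2015, LucaFriesecke2016, stmt-AtomisticToContinuum-0751]
#9 CertificateFromSpectralDomination (support) — (card L2, Mathlib-only) for every J : ℕ → ℝ with Σ
k²|J_k| < ∞ and every θ: Σ_(k≥2 even) J_k + (Σ_(k≥3 odd) J_k)·cos θ + (−2J₂ − ½Σ_(k≥3)
k²|J_k|)·sin²θ ≤ Σ_(k≥2) J_k cos(kθ). Proof: the k = 2 term is exact (J₂(cos 2θ − 1) = −2J₂ sin²θ);
for k ≥ 3, |cos kθ − L_k(cos θ)| ≤ (k²/2) sin²θ where L_k = 1 (k even), cos θ (k odd): even k, 1 −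
cos kθ = 2 sin²(kθ/2) ≤ (k²/2) sin²θ by |sin mφ| ≤ m|sin φ|; odd k, |cos θ − cos kθ| =
2|sin((k+1)θ/2) sin((k−1)θ/2)| ≤ ((k²−1)/2) sin²θ. No sign hypothesis on J is needed. [difficulty:
provable-now] [PolyaSzego1925, LuttingerTisza1946]
#9 SpectralFaultBound (support) — (card L1, the Luttinger–Tisza/Toeplitz core, Mathlib-only) for J
with Σ k|J_k| < ∞, reals b and q ≥ 0, a Hägg sequence s and n ∈ ℕ: if Σ_(k≥2 even) J_k + b cos θ + q
sin²θ ≤ Σ_(k≥2) J_k cos(kθ) for all θ, then n·Σ_(k≥2 even) J_k + (q/2)·#{m < n : s(m+1) = s(m)} ≤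
haggEnergy n J s + 2Σ_k k|J_k|. Proof (planner NOTES.md §Math): with z_m = ω^(haggLabel s m),
1[HaggAligned s m k] = (1 + 2Re z_m z̄_(m+k))/3, Re z_m z̄_(m+1) = −1/2, Re z_m z̄_(m+2) = 1 −
(3/2)·1[s(m+1) = s(m)]; positivity of (1/2π)∫ P(θ)|Σ_(m<n) z_m e^(−imθ)|² dθ for the nonnegative
symbol P = Ĵ − a − b cos − q sin² gives n·p₀ + Σ_(k≥1) p_k Σ_(m+k<n) Re z_m z̄_(m+k) ≥ 0 (p₀ = −a −
q/2, p₁ = −b, p₂ = J₂ + q/2, p_k = J_k); the hypothesis at θ = 0, π forces b = Σ_odd J_k, at θ = π/2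
gives q ≤ Σ k|J_k|; truncation and boundary terms total ≤ (10/9)Σ k|J_k| < 2Σ k|J_k|. [difficulty:
M] [LuttingerTisza1946, LyonsKaplan1960, Katznelson2004, CohnKumar2006, Delsarte1973,
RadinSchulman1983]
#9 SelectionGlue (support) — LjSpectralDomination → CertificateFromSpectralDomination →
SpectralFaultBound → LjFaultCountedSelection (take q₀ = −2J₂ − ½Σ_(k≥3)k²|J_k| ≥ |J₂|, weaken to q =
|J₂|, b = Σ_odd J_k; Summable k|J_k| from k²|J_k|). PROVED sorry-free in the planner's Sketch.lean
(selectionGlue_provable); a prover copies it. [difficulty: provable-now] [LuttingerTisza1946]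
#9 HcpPeriodicMinimiser (support) — shared verbatim with stmt-AtomisticToContinuum-3061 (target of
PoissonBesselStacking): some relaxed hcp stacking hcpPeriodicConfiguration a h with (a,h) ∈ B is a
least element of the Lennard-Jones energy per particle over all periodic configurations of ℝ³; here
the conclusion of EnergeticGlueLT. [difficulty: XL] [Stillinger2001, PartayOrtnerCsanyi2017,
BlancLewin2015, stmt-AtomisticToContinuum-3061]
#9 EnergeticGlueLT (support) — LjFaultCountedSelection → PeriodicReductionToBarlow →
BarlowEnergyIdentification → HcpEnergyMinOnBox → HcpPeriodicMinimiser. Proof: for Q take the Barlow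
competitor (a,h,s,p) of the reduction; by the identification e(barlow a h s) = e₀(a,h) + H_p/p;
p-periodicity gives H_(pm) = m·H_p (haggLocalEnergy_periodic), so X at n = pm (fault term ≥ 0
dropped) gives Σ_even J_k ≤ H_p/p + 2Σk|J_k|/(pm) → Σ_even J_k ≤ H_p/p; hcpPeriodicConfiguration ha
hh is by definition barlowPeriodicConfiguration alternatingHagg ha hh two_ne_zero _, so the
identification with haggEnergy_alternating gives e(hcp a h) = e₀(a,h) + Σ_even J_k ≤ e(Q); finally
e(hcp a₀ h₀) ≤ e(hcp a h) by HcpEnergyMinOnBox, and hcp a₀ h₀ is periodic: IsLeast. [difficulty: S]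
[RadinSchulman1983, BlancLewin2015]
#9 BarlowEnergyIdentification (support) — shared verbatim with stmt-AtomisticToContinuum-3065: for
a, h > 0 and a p-periodic Hägg sequence s, energyPerParticle lennardJones
(barlowPeriodicConfiguration a h s) = barlowBaseEnergy lennardJones a h + haggEnergy p
(barlowCoupling lennardJones a h) s / p (regrouping of the absolutely convergent LJ lattice sum by
layers; barlowSiteEnergy_average_eq_haggEnergy + PeriodicConfigurationSums). [difficulty:
provable-now] [BlancLewin2015, PartayOrtnerCsanyi2017, stmt-AtomisticToContinuum-3065]
#9 HcpEnergyMinOnBox (support) — shared verbatim with stmt-AtomisticToContinuum-3066: (a,h) ↦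
energyPerParticle lennardJones (hcpPeriodicConfiguration a h) attains its minimum over the compact
box B (continuity = uniform convergence of the LJ lattice sums on B). [difficulty: provable-now]
[BlancLewin2015, BeterminSamajTravenec2022, stmt-AtomisticToContinuum-3066]
#9 CrysEnergyLimit (support) — shared verbatim with stmt-AtomisticToContinuum-0626: E(N)/N → ⨅ over
periodic configurations of the LJ energy per particle (thermodynamic-limit bookkeeping:
periodisation 0715 + trial blocks 0629 + BlancLewin2015 (8)). [difficulty: M] [BlancLewin2015,
stmt-AtomisticToContinuum-0626]
#9 DefectVanishCrystallizes (support) — shared verbatim with stmt-AtomisticToContinuum-0752: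
BulkDefectVanish + the uniform minimal distance of LJ ground states (LennardJonesMinimalDistance,
proved: LennardJonesMinimalDistance_holds) ⇒ IsCrystallizing lennardJones 3 (good particles as
centres, convergent subsequence of isometries in O(3), tendsto_sum_of_eventually_near). [difficulty:
M] [BlancLewin2015, stmt-AtomisticToContinuum-0752]

TWO-LAYER PLAN. Foreseen glued splits (none filed now): LjSpectralDomination ⇐
RegistryCouplingBesselTail (PoissonBesselStacking's 3068: J_k < 0 and |J_k| ≤ 20·exp(−(4π/√3)(h/a)k)
for k ≥ 2 on B) → J2UpperBound (J₂(a,h) ≤ −3·10⁻⁵ on B, a one-term certified Bessel/interval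
evaluation) → LjSpectralDomination (margin ≈ 10 with the crude constant 20).
PeriodicReductionToBarlow and BulkDefectVanish split as in their home routes (PeriodicLayering →
LayeredReducesToUniformBarlow; K1 SoftTwelveCoordination + K2 RobustFejesTothHales +
StackingFaultBound 0759, the last now fed by the counted fault price of X). SpectralFaultBound, if a
prover wants it smaller: ToeplitzPositivity (∫P|S_n|² ≥ 0 expanded for an absolutely summable cosine
series P ≥ 0) → RegistryPhaseIdentities (the three identities for z_m) → SpectralFaultBound — these
are --supports lemmas, not items.

KILL CRITERIA. A certified evaluation showing J₂(a,h) ≥ 0 or Σ_(k≥3)k²|J_k| > 2|J₂| at some point of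
B refutes LjSpectralDomination and closes THIS route (close --reason refuted:LjSpectralDomination);
if J₂ < 0 survives but only the k² tail fails, pivot by --restate to the weaker certificate actually
needed (∃ q > 0 with Ĵ ≥ Σ_even + Σ_odd cos + q sin², checkable by a finite trigonometric-polynomial
positivity certificate) before closing. Refutation of SpectralFaultBound or
CertificateFromSpectralDomination as TYPED (a constant wrong) forces a restate with the corrected
constant, not a close (the mechanism has slack 8/9·Σk|J_k|). Refutation of PeriodicReductionToBarlow
with hcp still optimal in a smaller box forces the common pivot of all three stacking routes to B' ⊂
B; refutation of HcpPeriodicMinimiser (a periodic Q below every relaxed hcp) closes every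
hcp-targeted line including this one. BulkDefectVanish refuted (persistent polytetrahedral bulk
order) kills the positional half of every sphere-packing-heritage route; this route then shrinks to
the energetic conjunct (target HcpPeriodicMinimiser ∧ CrysEnergyLimit). HcpPeriodicMinimiser proved
first via PoissonBesselStacking's EnergeticGlue or KarpPeierlsStackingLock's LockedBoxMinimiser
moots EnergeticGlueLT but not X (the counted fault price remains wanted by BulkDefectVanish/0759).

NOT DECOMPOSED YET. The measure-level corollary (shift-invariant registry laws on B with minimal
specific energy have zero fault probability; fault density ≤ 2·excess/|J₂|) — X averaged, filed only
when an infinite-volume route (BenjaminiSchrammGroundStates, palm-unimodular, hull-minimality) asks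
for it; the uniqueness/complementary-slackness statement 'spectral measure = ¼δ₀ + ¾δ_π' (not
needed: the counted form is stronger); the explicit value q₀ = 2|J₂| − ½Σk²|J_k| versus the typed q
= |J₂| (a factor 2 in the fault price, irrelevant against O(N^(2/3))); layer-dependent relaxation
near faults (enters PeriodicReductionToBarlow / BulkDefectVanish exactly as in the sibling routes,
absorbed by the fault price); the Poisson–Bessel machinery behind LjSpectralDomination
(PoissonBesselStacking's engine, shared at split time); rotations/Wulff constants; which box corner
is the true optimum (IsLeast is order-theoretic).

CHEAPEST FALSIFIER. Evaluate min over θ ∈ (0,π) of Ĵ(θ) − Σ_even J_k − (Σ_odd J_k) cos θ − |J₂|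
sin²θ with certified intervals for J₂, J₃, J₄ and a geometric tail bound at the four corners of B
(minutes of interval arithmetic once the one-term Bessel formula of PoissonBesselStacking is
certified; a negative value anywhere kills LjSpectralDomination's consequence and hence the line for
LJ). Uncertified versions were run twice: card author (direct layer sums, a = 1 and 0.9712, ideal
c/a: slack at θ = π/2 equals 2|J₂| = 1.28·10⁻⁴, minimum of (Ĵ − a − b cos)/sin² over a 2000-point
grid = −2J₂ > 0, ratio of curvature to tail ≈ 400) and PoissonBesselStacking planner (7×8 grid of B:
J₂ ∈ [−1.5e−4, −3.68e−5], all J_k < 0 for 2 ≤ k ≤ 12, (k−1)-ratio ≥ 286.9 ⇒ k²-ratio ≥ 64). Not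
re-run here (compute-free hub; the inequality is linear in (J_k), so the sibling's box scan
transfers).

NUMBERS. a* = 0.9712 (LJ hcp nearest-neighbour distance, r₀ = 1), ideal h/a = √(2/3) = 0.8165; J₁ =
+0.78 (holes lock), J₂ = −7.25·10⁻⁵ (card: −6.42·10⁻⁵ at a = 1), J₃ = −8.45·10⁻⁸, J₄ = −1.1·10⁻¹⁰,
J₅ ≈ −1.7·10⁻¹³ (decay e^(−5.9k)); a = Σ_even J_k ≈ J₂, b = Σ_odd J_k ≈ J₃; e(hcp) − e(fcc) per
layer = (J₂ + J₄ + …) − (J₃ + J₆ + …) ≈ −7.2·10⁻⁵ (LoachAckland2017: H₂ ≈ −0.0009ε); spectral slack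
q₀ = 2|J₂| − ½Σ_(k≥3)k²|J_k| ≈ 1.99|J₂|; typed fault price |J₂|/2 ≥ 1.84·10⁻⁵ on B; Toeplitz
boundary constant used 2Σk|J_k| (derived need (10/9)Σk|J_k|); hcp spectral measure σ = ¼δ₀ + ¾δ_π,
r(k) = ¼ + ¾(−1)^k. Items at open: 14 (1 target, 3 cruxes, 9 support, 1 assembly).

DEFINITION REQUESTS. None: everything is typed over HaggStacking / BarlowStacking /
BarlowStackingEnergy / Crystallization / LennardJonesClusters (IsHaggSeq, haggEnergy,
barlowCoupling, barlowPeriodicConfiguration, hcpPeriodicConfiguration, barlowBaseEnergy,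
PeriodicConfiguration.energyPerParticle, groundStateEnergy, IsGroundState, IsCrystallizing,
LennardJonesMinimalDistance — all `lean search --decl`-verified and elaborated in Sketch.lean). Bib
keys added this session: LuttingerTisza1946, LyonsKaplan1960.

Novelty: Searches (2026-08-15): `lit frontier AtomisticToContinuum --since 2020` (30 rows, kinetic-theory
dominated; crystallization rows arXiv:2407.20762, arXiv:2604.19239 — planar/polycrystal, nothing on
stacking); `lit bridges AtomisticToContinuum --cross any` (30 rows, none on polytypes); `lit search
--source crossref "Luttinger-Tisza polytype stacking ground state"` (8: LuttingerTisza1946, Litvin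
1974 doi:10.1016/0031-8914(74)90257-2, Karl 1973 doi:10.1103/physrevb.7.2050, Misra 1973
doi:10.1103/physrevb.8.2026 — the method and when it is exact, all for spin/dipole lattices); `lit
galaxy search "Luttinger-Tisza" --star all` (16 rows: Heisenberg/Kitaev/dipolar ground states only,
e.g. Schmidt arXiv:1701.02489 'for Bravais lattices any ground state found via Luttinger–Tisza…');
`lit galaxy search "ANNNI model" --star all` (20 rows: Price–Ross 'The Stability of Minerals'
panama:252526897135642 = the ANNNI description of polytypism, J. Stat. Phys. 79 (1995) quantum ANNNI
chain); `lit search --source crossref "ground states one-dimensional Potts model competing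
interactions polytypes"` (8: Hajduković–Šavić 1984 doi:10.1002/pssb.2221250255, found by the novelty
audit too); `lit search --hybrid` ×2 on the local index (textbook hits only: Kaxiras 2003 p.392,
Holt–Yacobi 2007 pp.207–212 on SiC polytypes); openalex/s2/arxiv rate-limited (HTTP 429) at 11:35Z.
In-tree: no Theses file of the sub uses a registry-phase variable, a spectral measure or a Toeplitz
form (grep Luttinger|Toeplitz|Her  [refs: 10.1016/0031-8914(74, 10.1103/physrevb.7.2050, 10.1103/physrevb.8.2026, 10.1002/pssb.2221250255, 2407.20762, 2604.19239, 1701.02489, doi:10.1016/0031-8914, doi:10.1103/physrevb.7.2050, doi:10.1103/physrevb.8.2026, doi:10.1002/pssb.2221250255, LuttingerTisza1946, LyonsKaplan1960, PartayOrtnerCsanyi2017, LoachAckland2017]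

Barriers (technique_class: luttinger-tisza-relaxation, delsarte-lp, toeplitz-psd): - technique_class: luttinger-tisza-relaxation, delsarte-lp, toeplitz-psd
- Literature.Barriers.AtomisticToContinuum.ShortRangeStackingBlindness: USED, not met — the
certificate lives entirely in the tail data (J_k)_(k≥2), i.e. in the interaction beyond height 2h ≥
1.47 > √(8/3)·0.9 (the barrier's own listed evasion 'tail beyond √(8/3)'); a truncated potential has
Ĵ ≡ 0 and the line correctly certifies nothing.
- Literature.Barriers.AtomisticToContinuum.Hubbard1978_mostHomogeneous: APPLIES to any reduction to
a 1-D chain with infinite-range couplings (Sturmian / devil's-staircase ground states when scales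
compete, MostHomogeneousGroundStates.lean); evaded by certificate, not by assumption —
LjSpectralDomination is exactly the statement that LJ sits inside the open hcp plateau (q₀ ≈ 2|J₂| >
0), and the narrowed barrier (Hubbard1978_mostHomogeneousNarrow) defeats periodicity only at
prescribed irrational densities / exceptional chemical potentials, a regime the registry chain with
dominant J₂ < 0 is certified to avoid; card aperiodic-by-design-radial-polytypes shows the
hypothesis is load-bearing.
- Literature.Barriers.AtomisticToContinuum.AperiodicTilingGroundStates: does not meet the 1-D part
(Radin: every finite-range 1-D problem has a periodic ground state; here infinite range is handled
by the certificate's K = ∞ validity and the O(1) boundary term 2Σk|J_k|); the 3-D layering inputs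
are where tiling-type aperiodicity could bite, conceded to PeriodicReductionToBarlow / BulkD

Novelty grade: new-combination — ROUTE REVIEW (refuter, 2026-08-15; full text = REVIEW-LuttingerTiszaRegistry.md, evidence on stmt-4337). VERDICT keep; nothing false; not a recombination of closed routes (CrystalLocalRigidity/RefuteCrystalPeriodicMin are different lines; shared XL cruxes 3062/0751 live in OPEN siblings). ON PAPER:  (refuter refuter-rreview-route-AtomisticToContinu-771e1018-0, 2026-08-15T13:37:45Z; prior: LuttingerTisza1946, LyonsKaplan1960, Delsarte1973, CohnKumar2006, Katznelson2004, doi:10.1002/pssb.2221250255, PartayOrtnerCsanyi2017, LoachAckland2017)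

History (route lifecycle, newest last):
- 2026-08-16T03:47:35Z · AUTO-CRUX (backfill): LjFaultCountedSelection — hypotheses of the deciding theorem that nothing in the route derives are cruxes (operator:999:586464)
- 2026-08-23T14:31:55Z · DORMANT — reconciler: no traction for 6.1 d (last activity statement-grounded at 2026-08-17T11:42:18Z); parked, not closed — `ledger route dormant route-AtomisticToContin (operator:999:775239)
- 2026-08-31T09:28:32Z · REACTIVATED (open) — reconciler: reactivated — activity statement-checked at 2026-08-31T08:34:34Z after parking at 2026-08-23T14:31:55Z (operator:999:2645944)

sub-problem: Crystallization · status: open · opened planner-plancard-AtomisticToContinuum-Crystal-70f83157-0 2026-08-15T11:32:37Z · rev 2 · ledger route-AtomisticToContinuum-LuttingerTiszaRegistry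
GENERATED by the gate from the ledger (D-0016/17). Provers cite these decls: `theorem foo : Summit.AtomisticToContinuum.Crystallization.Theses.LuttingerTiszaRegistry.<Decl> := …` in Summits/AtomisticToContinuum/Crystallization/Theorems/<Name>.lean.
-/

namespace Summit.AtomisticToContinuum.Crystallization.Theses.LuttingerTiszaRegistry

open scoped BigOperators Topology Manifold Classical MeasureTheory ProbabilityTheory Matrix InnerProductSpace ComplexConjugate ContinuousMap
open Filter Set Function TopologicalSpace MeasureTheory

attribute [summit_statement] _root_.Crystallization

/-- item stmt-AtomisticToContinuum-4337 · crux (kind.auto-crux: conjecture-grade) · rank 0 · open · by planner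
why it might fail: Inherits LjSpectralDomination's risk: false iff J₂(a,h) ≥ 0 somewhere on B (|J₂| smallest, 3.7e−5, at (1,0.85a)) or the k≥3 tail is not k²-dominated there; the Toeplitz constant 2Σk|J_k| is safe (derived need (10/9)Σk|J_k|, refuter's cruder (5/3)Σk|J_k|).
sources: LuttingerTisza1946, LyonsKaplan1960, LoachAckland2017, PartayOrtnerCsanyi2017, Stillinger2001, stmt-AtomisticToContinuum-4337
[target] X as in § Thesis: for all (a,h) ∈ B, J₂(a,h) < 0 and for every Hägg sequence s and every n,
n·Σ_(k≥2 even) J_k(a,h) + (|J₂(a,h)|/2)·#{m < n : s(m+1) = s(m)} ≤ haggEnergy n J(a,h) s + 2 Σ_k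
k|J_k(a,h)| (card items L1+L2+L3 composed; follows from LjSpectralDomination by SelectionGlue,
proved in Sketch.lean). -/
@[route_item "route-AtomisticToContinuum-LuttingerTiszaRegistry", crux]
def LjFaultCountedSelection : Prop :=
  ∀ a h : ℝ, 47 / 50 ≤ a → a ≤ 1 → 39 / 50 * a ≤ h → h ≤ 17 / 20 * a → Literature.MathematicalPhysics.StatisticalMechanics.barlowCoupling Literature.MathematicalPhysics.StatisticalMechanics.lennardJones a h 2 < 0 ∧ ∀ (s : ℤ → ℤ) (n : ℕ), Literature.MathematicalPhysics.StatisticalMechanics.IsHaggSeq s → (n : ℝ) * (∑' k : ℕ, (if 2 ≤ k ∧ Even k then Literature.MathematicalPhysics.StatisticalMechanics.barlowCoupling Literature.MathematicalPhysics.StatisticalMechanics.lennardJones a h k else 0)) + |Literature.MathematicalPhysics.StatisticalMechanics.barlowCoupling Literature.MathematicalPhysics.StatisticalMechanics.lennardJones a h 2| / 2 * (((Finset.range n).filter (fun m : ℕ => s ((m : ℤ) + 1) = s (m : ℤ))).card : ℝ) ≤ Literature.MathematicalPhysics.StatisticalMechanics.haggEnergy n (Literature.MathematicalPhysics.StatisticalMechanics.barlowCoupling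 Literature.MathematicalPhysics.StatisticalMechanics.lennardJones a h) s + 2 * ∑' k : ℕ, (k : ℝ) * |Literature.MathematicalPhysics.StatisticalMechanics.barlowCoupling Literature.MathematicalPhysics.StatisticalMechanics.lennardJones a h k|

/-- item stmt-AtomisticToContinuum-4338 · crux · rank 2 · open · by planner
why it might fail: Certified numerics on a continuum box: J₂<0 must hold on ALL of B; worst corner (1,0.85a) has |J₂|=3.7e−5, a 10⁻³-relative cancellation of two layer sums (3 float runs agree, k²-margin ≥127, none certified); as typed, unproved summability sends layerInteraction to junk 0, making 'J₂<0' false.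
sources: LoachAckland2017, PartayOrtnerCsanyi2017, Stillinger2001, BurrowsEtAl2020, BeterminPetrache2017, LennardjonesDent1928
[crux] (card L3, the ONLY Lennard-Jones input of the line) for all (a,h) ∈ B, with J_k =
barlowCoupling lennardJones a h k: Σ_k k²|J_k| < ∞, J₂ < 0 and Σ_(k≥3) k²|J_k| ≤ 2|J₂|. Numerics
(uncertified; PoissonBesselStacking planner's Bessel series cross-checked by direct sums, card
author's direct sums): J₂ ∈ [−1.5·10⁻⁴, −3.68·10⁻⁵] on B, |J₃|/|J₂| ≤ 1/574, so Σ_(k≥3)k²|J_k| ≈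
9|J₃| ≈ |J₂|/64 at the worst corner (0.94, 0.78a): margin ≈ 128; already the crude tail bound |J_k|
≤ 20e^(−(4π/√3)(h/a)k) of RegistryCouplingBesselTail (3068) plus J₂ ≤ −3.68·10⁻⁵ gives margin ≈ 10.
Proof routes: 2-D Poisson summation per layer (J_k a modified-Bessel series, sign from the −r⁻⁶ part
at height kh ≥ 1.47) or direct interval lattice sums with an r⁻⁶ tail bound; the k² summability
alone follows from |J_k| ≤ C(kh)⁻⁴. [difficulty: L] -/
@[route_item "route-AtomisticToContinuum-LuttingerTiszaRegistry", crux]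
def LjSpectralDomination : Prop :=
  ∀ a h : ℝ, 47 / 50 ≤ a → a ≤ 1 → 39 / 50 * a ≤ h → h ≤ 17 / 20 * a → Summable (fun k : ℕ => (k : ℝ) ^ 2 * |Literature.MathematicalPhysics.StatisticalMechanics.barlowCoupling Literature.MathematicalPhysics.StatisticalMechanics.lennardJones a h k|) ∧ Literature.MathematicalPhysics.StatisticalMechanics.barlowCoupling Literature.MathematicalPhysics.StatisticalMechanics.lennardJones a h 2 < 0 ∧ ∑' k : ℕ, (if 3 ≤ k then (k : ℝ) ^ 2 * |Literature.MathematicalPhysics.StatisticalMechanics.barlowCoupling Literature.MathematicalPhysics.StatisticalMechanics.lennardJones a h k| else 0) ≤ 2 * |Literature.MathematicalPhysics.StatisticalMechanics.barlowCoupling Literature.MathematicalPhysics.StatisticalMechanics.lennardJones a h 2|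

/-- item stmt-AtomisticToContinuum-3062 · crux · rank 3 · open · by planner
why it might fail: Given the provable-now glue it says relaxed hcp with (a,h)∈B is THE periodic LJ minimiser — open even among lattice+motif configurations (BlancLewin2015 §2.3); false if a non-close-packed or layer-wise relaxed polytype undercuts every UNIFORM Barlow stacking in B, or if the optimum leaves B.
sources: BlancLewin2015, FlatleyTheil2015, Hales2012, Stillinger2001, PartayOrtnerCsanyi2017, BeterminSamajTravenec2022
[crux] (R) ENERGETIC LAYERING/REDUCTION (card item (3), the genuinely 3-D content): for every
periodic configuration Q of ℝ³ there are (a,h) ∈ B and a periodic Hägg sequence s such that the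
uniform Barlow stacking barlowPeriodicConfiguration a h s has Lennard-Jones energy per particle ≤
that of Q. Intended mechanism (foreseen split): near-optimal periodic Q are twelve-coordinated
stacks of triangular layers (Flyspeck L12 cap + LJ bond counting, as in CrystalKissingRigidity K1/K2
but for PERIODIC Q, no N → ∞ defects), lateral offsets are forced into the deep holes by
AdjacentLayerHoleLocking, and layer-dependent spacings relax to a uniform h by convexity of h ↦
Φ_N(h) (the registry corrections are ≤ 7.3e−5 with dJ₂/dh ≈ 5e−4 against an O(10) stiffness:
non-uniform relaxation gains ≲ 1e−8 per layer). [deps: AdjacentLayerHoleLocking] [difficulty: XL] -/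
@[route_item "route-AtomisticToContinuum-LuttingerTiszaRegistry", crux]
def PeriodicReductionToBarlow : Prop :=
  ∀ Q : Literature.MathematicalPhysics.StatisticalMechanics.PeriodicConfiguration 3, ∃ a h : ℝ, 47 / 50 ≤ a ∧ a ≤ 1 ∧ 39 / 50 * a ≤ h ∧ h ≤ 17 / 20 * a ∧ ∃ (s : ℤ → ℤ) (p : ℕ) (ha : a ≠ 0) (hh : h ≠ 0) (hp : p ≠ 0) (hs : ∀ i, s (i + p) = s i), Literature.MathematicalPhysics.StatisticalMechanics.IsHaggSeq s ∧ (Literature.MathematicalPhysics.StatisticalMechanics.barlowPeriodicConfiguration s ha hh hp hs).energyPerParticle Literature.MathematicalPhysics.StatisticalMechanics.lennardJones ≤ Q.energyPerParticle Literature.MathematicalPhysics.StatisticalMechanics.lennardJones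

/-- item stmt-AtomisticToContinuum-0751 · crux · rank 4 · open · by planner
why it might fail: Needs layering of finite LJ ground states: K1/K2 unproved, and soft twelve-kissing at 1% tolerance does NOT force an fcc/hcp contact graph (D5h shell, negatives 4146; Böröczky–Szabó); plus O(1) fault planes; as typed P must be vertex-transitive — hcp yes, dhcp-type limits no.
sources: Hales2012, BlancLewin2015, PartayOrtnerCsanyi2017, FlatleyTheil2015, LucaFriesecke2016, BoroczkySzabo2016
[crux] HINGE: there is ONE periodic configuration P (the LJ-optimal HCP-type stacking, 0 ∈ motif)
such that for every window radius R and tolerance ε, in every sequence of LJ ground states all but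
o(N) particles i admit a linear isometry A with the particles in B_R(x_i) ε-matched both ways to x_i
+ A(P.points ∩ B_R). Follows from (K1) SoftTwelveCoordination + (K2) RobustFejesTothHales + (K3)
stacking selection (Hägg domination 0716/0737 + certified J_k) with ≤ K fault planes per ground
state. Sources: Hales2012 Thm 1; HaggStacking.lean; PartayOrtnerCsanyi2017. -/
@[route_item "route-AtomisticToContinuum-LuttingerTiszaRegistry", crux]
def BulkDefectVanish : Prop :=
  ∃ P : Literature.MathematicalPhysics.StatisticalMechanics.PeriodicConfiguration 3, ∀ R ε : ℝ, 0 < R → 0 < ε → ∀ x : (N : ℕ) → (Fin N → EuclideanSpace ℝ (Fin 3)), (∀ N, Literature.MathematicalPhysics.StatisticalMechanics.IsGroundState Literature.MathematicalPhysics.StatisticalMechanics.lennardJones (x N)) → Filter.Tendsto (fun N : ℕ => (Nat.card {i : Fin N // ¬ ∃ A : EuclideanSpace ℝ (Fin 3) →ₗᵢ[ℝ] EuclideanSpace ℝ (Fin 3), (∀ p ∈ P.points, ‖p‖ ≤ R → ∃ j : Fin N, dist (x N j) (x N i + A p) ≤ ε) ∧ (∀ j : Fin N, dist (x N j) (x N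 i) ≤ R → ∃ p ∈ P.points, dist (x N j) (x N i + A p) ≤ ε)} : ℝ) / N) Filter.atTop (nhds 0)

/-- item stmt-AtomisticToContinuum-0626 · support · rank 9 · closed · proved by Summit.AtomisticToContinuum.Crystallization.Theorems.crysEnergyLimit_proof @ f456c3bab3f9 (prover) · by planner
sources: BlancLewin2015, stmt-AtomisticToContinuum-0626
Energetic crystallization: E(N)/N converges to the infimum over periodic (multi-lattice)
configurations of the LJ energy per particle in d = 3. Lower bound liminf ≥ ⨅ is the content ((a)
local optimality + (d) + surface term O(N^{2/3})); upper bound is filed separately. -/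
@[route_item "route-AtomisticToContinuum-LuttingerTiszaRegistry", crux]
def CrysEnergyLimit : Prop :=
  Filter.Tendsto (fun N : ℕ => Literature.MathematicalPhysics.StatisticalMechanics.groundStateEnergy Literature.MathematicalPhysics.StatisticalMechanics.lennardJones 3 N / N) Filter.atTop (nhds (⨅ Q : Literature.MathematicalPhysics.StatisticalMechanics.PeriodicConfiguration 3, Q.energyPerParticle Literature.MathematicalPhysics.StatisticalMechanics.lennardJones))

/-- `CrysEnergyLimit` holds: proved by `Summit.AtomisticToContinuum.Crystallization.Theorems.crysEnergyLimit_proof` @ f456c3bab3f9. -/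
theorem CrysEnergyLimit_holds : CrysEnergyLimit := _root_.Summit.AtomisticToContinuum.Crystallization.Theorems.crysEnergyLimit_proof

/-- item stmt-AtomisticToContinuum-0752 · support · rank 9 · closed · proved by Summit.AtomisticToContinuum.Crystallization.Theorems.ThreeConeCertificateDefectVanishCrystallizes.defectVanishCrystallizes_proof (prover) · by planner
sources: BlancLewin2015, stmt-AtomisticToContinuum-0752
[support] SOFT ASSEMBLY LEMMA: BulkDefectVanish together with the uniform minimal distance of LJ
ground states (Literature fact LennardJonesMinimalDistance, Xue 1997 / BlancLewin2015 §2.2) implies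
IsCrystallizing lennardJones 3: pick, for R_k = k, ε_k = 1/k, indices N_k ↑ and good particles i_k;
τ_k = −x_{i_k}; extract a convergent subsequence of the isometries A_k → A in O(3); minimal distance
+ discreteness of P make the ε-matching a local bijection, so Σ_i f(x_i + τ_k) → Σ_{s ∈ A(P.points)}
f(s) for f ∈ C_c; A(P) is again a PeriodicConfiguration (rotate lattice and motif), multiplicity m ≡
1. -/
@[route_item "route-AtomisticToContinuum-LuttingerTiszaRegistry", crux]
def DefectVanishCrystallizes : Prop :=
  BulkDefectVanish → Literature.MathematicalPhysics.StatisticalMechanics.LennardJonesMinimalDistance → Literature.MathematicalPhysics.StatisticalMechanics.IsCrystallizing Literature.MathematicalPhysics.StatisticalMechanics.lennardJones 3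

/-- `DefectVanishCrystallizes` holds: proved by `Summit.AtomisticToContinuum.Crystallization.Theorems.ThreeConeCertificateDefectVanishCrystallizes.defectVanishCrystallizes_proof`. -/
theorem DefectVanishCrystallizes_holds : DefectVanishCrystallizes := _root_.Summit.AtomisticToContinuum.Crystallization.Theorems.ThreeConeCertificateDefectVanishCrystallizes.defectVanishCrystallizes_proof

/-- item stmt-AtomisticToContinuum-3061 · support · rank 9 · open · by planner
sources: Stillinger2001, PartayOrtnerCsanyi2017, BlancLewin2015, stmt-AtomisticToContinuum-3061
[target] X_E: some relaxed HCP stacking with parameters (a,h) in the box B is a least element of the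
Lennard-Jones energy per particle over all periodic configurations of ℝ³ (names the minimiser that
0627 leaves anonymous). -/
@[route_item "route-AtomisticToContinuum-LuttingerTiszaRegistry", crux]
def HcpPeriodicMinimiser : Prop :=
  ∃ a h : ℝ, ∃ (ha : a ≠ 0) (hh : h ≠ 0), 47 / 50 ≤ a ∧ a ≤ 1 ∧ 39 / 50 * a ≤ h ∧ h ≤ 17 / 20 * a ∧ IsLeast (Set.range fun Q : Literature.MathematicalPhysics.StatisticalMechanics.PeriodicConfiguration 3 => Q.energyPerParticle Literature.MathematicalPhysics.StatisticalMechanics.lennardJones) ((Literature.MathematicalPhysics.StatisticalMechanics.hcpPeriodicConfiguration ha hh).energyPerParticle Literature.MathematicalPhysics.StatisticalMechanics.lennardJones)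

/-- item stmt-AtomisticToContinuum-3065 · support · rank 9 · closed · proved by Summit.AtomisticToContinuum.Crystallization.Theorems.PricedHcpWindowsBarlowEnergy.stub_barlowEnergyIdentification @ 48aba10f417a (prover) · by planner
sources: BlancLewin2015, PartayOrtnerCsanyi2017, stmt-AtomisticToContinuum-3065
[support] the regrouping left open in BarlowStackingEnergy.lean ('Not proved here'): for a, h > 0
and a p-periodic Hägg sequence s, the energy per particle (Crystallization.lean, tsum over the point
set) of barlowPeriodicConfiguration a h s equals barlowBaseEnergy lennardJones a h + haggEnergy p
(barlowCoupling lennardJones a h) s / p (absolute summability of the LJ lattice sum,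
PeriodicConfigurationSums.lean, + barlowSiteEnergy_average_eq_haggEnergy + motif card = p).
[difficulty: provable-now] -/
@[route_item "route-AtomisticToContinuum-LuttingerTiszaRegistry", crux]
def BarlowEnergyIdentification : Prop :=
  ∀ a h : ℝ, 0 < a → 0 < h → ∀ (s : ℤ → ℤ) (p : ℕ) (ha : a ≠ 0) (hh : h ≠ 0) (hp : p ≠ 0) (hs : ∀ i, s (i + p) = s i), Literature.MathematicalPhysics.StatisticalMechanics.IsHaggSeq s → (Literature.MathematicalPhysics.StatisticalMechanics.barlowPeriodicConfiguration s ha hh hp hs).energyPerParticle Literature.MathematicalPhysics.StatisticalMechanics.lennardJones = Literature.MathematicalPhysics.StatisticalMechanics.barlowBaseEnergy Literature.MathematicalPhysics.StatisticalMechanics.lennardJones a h + Literature.MathematicalPhysics.StatisticalMechanics.haggEnergy p (Literature.MathematicalPhysics.StatisticalMechanics.barlowCoupling Literature.MathematicalPhysics.StatisticalMechanics.lennardJones a h) s / p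

/-- `BarlowEnergyIdentification` holds: proved by `Summit.AtomisticToContinuum.Crystallization.Theorems.PricedHcpWindowsBarlowEnergy.stub_barlowEnergyIdentification` @ 48aba10f417a. -/
theorem BarlowEnergyIdentification_holds : BarlowEnergyIdentification := _root_.Summit.AtomisticToContinuum.Crystallization.Theorems.PricedHcpWindowsBarlowEnergy.stub_barlowEnergyIdentification

/-- item stmt-AtomisticToContinuum-3066 · support · rank 9 · open · by planner
sources: BlancLewin2015, BeterminSamajTravenec2022, stmt-AtomisticToContinuum-3066
[support] continuity/compactness: (a,h) ↦ energyPerParticle lennardJones (hcpPeriodicConfiguration a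
h) attains its minimum over the compact box B at some (a₀,h₀) ∈ B (uniform convergence of the LJ
lattice sums on B). [difficulty: provable-now] -/
@[route_item "route-AtomisticToContinuum-LuttingerTiszaRegistry", crux]
def HcpEnergyMinOnBox : Prop :=
  ∃ a₀ h₀ : ℝ, ∃ (ha₀ : a₀ ≠ 0) (hh₀ : h₀ ≠ 0), 47 / 50 ≤ a₀ ∧ a₀ ≤ 1 ∧ 39 / 50 * a₀ ≤ h₀ ∧ h₀ ≤ 17 / 20 * a₀ ∧ ∀ a h : ℝ, ∀ (ha : a ≠ 0) (hh : h ≠ 0), 47 / 50 ≤ a → a ≤ 1 → 39 / 50 * a ≤ h → h ≤ 17 / 20 * a → (Literature.MathematicalPhysics.StatisticalMechanics.hcpPeriodicConfiguration ha₀ hh₀).energyPerParticle Literature.MathematicalPhysics.StatisticalMechanics.lennardJones ≤ (Literature.MathematicalPhysics.StatisticalMechanics.hcpPeriodicConfiguration ha hh).energyPerParticle Literature.MathematicalPhysics.StatisticalMechanics.lennardJones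

/-- item stmt-AtomisticToContinuum-4339 · support · rank 9 · open · by planner
sources: PolyaSzego1925, LuttingerTisza1946
[support] (card L2, Mathlib-only) for every J : ℕ → ℝ with Σ k²|J_k| < ∞ and every θ: Σ_(k≥2 even)
J_k + (Σ_(k≥3 odd) J_k)·cos θ + (−2J₂ − ½Σ_(k≥3) k²|J_k|)·sin²θ ≤ Σ_(k≥2) J_k cos(kθ). Proof: the k
= 2 term is exact (J₂(cos 2θ − 1) = −2J₂ sin²θ); for k ≥ 3, |cos kθ − L_k(cos θ)| ≤ (k²/2) sin²θ
where L_k = 1 (k even), cos θ (k odd): even k, 1 − cos kθ = 2 sin²(kθ/2) ≤ (k²/2) sin²θ by |sin mφ|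
≤ m|sin φ|; odd k, |cos θ − cos kθ| = 2|sin((k+1)θ/2) sin((k−1)θ/2)| ≤ ((k²−1)/2) sin²θ. No sign
hypothesis on J is needed. [difficulty: provable-now] -/
@[route_item "route-AtomisticToContinuum-LuttingerTiszaRegistry", crux]
def CertificateFromSpectralDomination : Prop :=
  ∀ J : ℕ → ℝ, Summable (fun k : ℕ => (k : ℝ) ^ 2 * |J k|) → ∀ θ : ℝ, (∑' k : ℕ, (if 2 ≤ k ∧ Even k then J k else 0)) + (∑' k : ℕ, (if 3 ≤ k ∧ Odd k then J k else 0)) * Real.cos θ + (-2 * J 2 - (1 / 2) * ∑' k : ℕ, (if 3 ≤ k then (k : ℝ) ^ 2 * |J k| else 0)) * Real.sin θ ^ 2 ≤ ∑' k : ℕ, (if 2 ≤ k then J k * Real.cos ((k : ℝ) * θ) else 0)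

/-- item stmt-AtomisticToContinuum-4340 · support · rank 9 · open · by planner
sources: LuttingerTisza1946, LyonsKaplan1960, Katznelson2004, CohnKumar2006, Delsarte1973, RadinSchulman1983
[support] (card L1, the Luttinger–Tisza/Toeplitz core, Mathlib-only) for J with Σ k|J_k| < ∞, reals
b and q ≥ 0, a Hägg sequence s and n ∈ ℕ: if Σ_(k≥2 even) J_k + b cos θ + q sin²θ ≤ Σ_(k≥2) J_k
cos(kθ) for all θ, then n·Σ_(k≥2 even) J_k + (q/2)·#{m < n : s(m+1) = s(m)} ≤ haggEnergy n J s +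
2Σ_k k|J_k|. Proof (planner NOTES.md §Math): with z_m = ω^(haggLabel s m), 1[HaggAligned s m k] = (1
+ 2Re z_m z̄_(m+k))/3, Re z_m z̄_(m+1) = −1/2, Re z_m z̄_(m+2) = 1 − (3/2)·1[s(m+1) = s(m)];
positivity of (1/2π)∫ P(θ)|Σ_(m<n) z_m e^(−imθ)|² dθ for the nonnegative symbol P = Ĵ − a − b cos −
q sin² gives n·p₀ + Σ_(k≥1) p_k Σ_(m+k<n) Re z_m z̄_(m+k) ≥ 0 (p₀ = −a − q/2, p₁ = −b, p₂ = J₂ +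
q/2, p_k = J_k); the hypothesis at θ = 0, π forces b = Σ_odd J_k, at θ = π/2 gives q ≤ Σ k|J_k|;
truncation and boundary terms total ≤ (10/9)Σ k|J_k| < 2Σ k|J_k|. [difficulty: M] -/
@[route_item "route-AtomisticToContinuum-LuttingerTiszaRegistry", crux]
def SpectralFaultBound : Prop :=
  ∀ (J : ℕ → ℝ) (b q : ℝ) (s : ℤ → ℤ) (n : ℕ), Literature.MathematicalPhysics.StatisticalMechanics.IsHaggSeq s → Summable (fun k : ℕ => (k : ℝ) * |J k|) → 0 ≤ q → (∀ θ : ℝ, (∑' k : ℕ, (if 2 ≤ k ∧ Even k then J k else 0)) + b * Real.cos θ + q * Real.sin θ ^ 2 ≤ ∑' k : ℕ, (if 2 ≤ k then J k * Real.cos ((k : ℝ) * θ) else 0)) → (n : ℝ) * (∑' k : ℕ, (if 2 ≤ k ∧ Even k then J k else 0)) + q / 2 * (((Finset.range n).filter (fun m : ℕ => s ((m : ℤ) + 1) = s (m : ℤ))).card : ℝ) ≤ Literature.MathematicalPhysics.StatisticalMechanics.haggEnergy n J s + 2 * ∑' k : ℕ, (k : ℝ) * |J k|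

/-- item stmt-AtomisticToContinuum-4341 · support · rank 9 · open · by planner
sources: LuttingerTisza1946
[support] LjSpectralDomination → CertificateFromSpectralDomination → SpectralFaultBound →
LjFaultCountedSelection (take q₀ = −2J₂ − ½Σ_(k≥3)k²|J_k| ≥ |J₂|, weaken to q = |J₂|, b = Σ_odd J_k;
Summable k|J_k| from k²|J_k|). PROVED sorry-free in the planner's Sketch.lean
(selectionGlue_provable); a prover copies it. [difficulty: provable-now] -/
@[route_item "route-AtomisticToContinuum-LuttingerTiszaRegistry", crux]
def SelectionGlue : Prop :=
  LjSpectralDomination → CertificateFromSpectralDomination → SpectralFaultBound → LjFaultCountedSelection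

/-- item stmt-AtomisticToContinuum-4342 · support · rank 9 · open · by planner
sources: RadinSchulman1983, BlancLewin2015
[support] LjFaultCountedSelection → PeriodicReductionToBarlow → BarlowEnergyIdentification →
HcpEnergyMinOnBox → HcpPeriodicMinimiser. Proof: for Q take the Barlow competitor (a,h,s,p) of the
reduction; by the identification e(barlow a h s) = e₀(a,h) + H_p/p; p-periodicity gives H_(pm) =
m·H_p (haggLocalEnergy_periodic), so X at n = pm (fault term ≥ 0 dropped) gives Σ_even J_k ≤ H_p/p +
2Σk|J_k|/(pm) → Σ_even J_k ≤ H_p/p; hcpPeriodicConfiguration ha hh is by definition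
barlowPeriodicConfiguration alternatingHagg ha hh two_ne_zero _, so the identification with
haggEnergy_alternating gives e(hcp a h) = e₀(a,h) + Σ_even J_k ≤ e(Q); finally e(hcp a₀ h₀) ≤ e(hcp
a h) by HcpEnergyMinOnBox, and hcp a₀ h₀ is periodic: IsLeast. [difficulty: S] -/
@[route_item "route-AtomisticToContinuum-LuttingerTiszaRegistry", crux]
def EnergeticGlueLT : Prop :=
  LjFaultCountedSelection → PeriodicReductionToBarlow → BarlowEnergyIdentification → HcpEnergyMinOnBox → HcpPeriodicMinimiser

/-- item stmt-AtomisticToContinuum-4343 · assembly · rank 1 · open · by planner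
sources: BlancLewin2015, LuttingerTisza1946
[assembly] LjFaultCountedSelection → PeriodicReductionToBarlow → BarlowEnergyIdentification →
HcpEnergyMinOnBox → EnergeticGlueLT → CrysEnergyLimit → BulkDefectVanish → DefectVanishCrystallizes
→ LennardJonesMinimalDistance → Crystallization. -/
@[route_item "route-AtomisticToContinuum-LuttingerTiszaRegistry", crux]
def Assembly : Prop :=
  LjFaultCountedSelection → PeriodicReductionToBarlow → BarlowEnergyIdentification → HcpEnergyMinOnBox → EnergeticGlueLT → CrysEnergyLimit → BulkDefectVanish → DefectVanishCrystallizes → Literature.MathematicalPhysics.StatisticalMechanics.LennardJonesMinimalDistance → Crystallization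

/-! D-0027 §2.1 — DECIDING THEOREM (planner-authored via `route open/edit --closes-file`; by planner-rbadge-AtomisticToContinuum-LuttingerT-c67cd207-g2-0 2026-08-15T16:12:43Z):
its hypotheses are this route's items and its conclusion the sub-problem Statement (glue_lint), and it elaborates with this file. -/

@[closes "route-AtomisticToContinuum-LuttingerTiszaRegistry"] theorem closes : LjFaultCountedSelection → LjSpectralDomination → PeriodicReductionToBarlow → BulkDefectVanish → CrysEnergyLimit → DefectVanishCrystallizes → HcpPeriodicMinimiser → BarlowEnergyIdentification → HcpEnergyMinOnBox → CertificateFromSpectralDomination → SpectralFaultBound → SelectionGlue → EnergeticGlueLT → Assembly → _root_.Crystallization := fun _hX hSD hPR hBDV hCEL hDVC _hHPM hBEI hHEM hCSD hSFB hSG hEG _hA => by obtain ⟨a, h, ha, hh, -, -, -, -, hl⟩ := hEG (hSG hSD hCSD hSFB) hPR hBEI hHEM; exact ⟨⟨_, hl, by unfold CrysEnergyLimit at hCEL; rw [← sInf_range, hl.csInf_eq] at hCEL; exact hCEL⟩, hDVC hBDV Literature.MathematicalPhysics.StatisticalMechanics.LennardJonesMinimalDistance_holds⟩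

end Summit.AtomisticToContinuum.Crystallization.Theses.LuttingerTiszaRegistry
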